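import Mathlib
import Summits.Ventures.PercRepro2.UniversalBundleStep
import Summits.Ventures.PercRepro2.UniversalDoubleBundleSP
import Summits.Ventures.PercRepro2.UniversalSeriesBundlesSP

/-! # The series step `s ∧ B_K` on the cell's own SP terms
(seat mine-b, cell pub-perc-repro2; MINE-B.md §25.2, §25.7)

`universal_ser_bundle` (UniversalBundleStep.lean) lives on the abstract cube `X × Finset (Fin K)`.
Here it is carried to the SP term `SP.ser s (SP.bundle K)` for every term `s`: the configuration
type `s.Conf × (SP.bundle K).Conf` is identified with `s.Conf × Finset (Fin K)` by `bundleIso`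
(`sbsIso`), the labels are `serR s.rLab rB` / `serB s.bLab bB` along it (`SP.rLab_ser_bundle`,
`SP.bLab_ser_bundle`), and `universal_transport` carries the assignment over:
**`SP.universal_ser_bundle`** — for every SP term `s` whose cube carries an (UH*) assignment `f`,
a red-up map `θ` and the (L1) datum `g`, and every `K ≥ 3`, (UH*) holds on `s ∧ B_K`. -/

namespace Summit.Ventures.PercRepro2.V2Closure

open Finset
open Summit.Ventures.PercRepro2.UHClosure

/-- the cube of `s ∧ B_K`: the second coordinate as a finset of blue edges -/
def sbsIso (s : SP) (K : ℕ) : (SP.ser s (SP.bundle K)).Conf ≃o s.Conf × Finset (Fin K) :=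
  prodIso (OrderIso.refl s.Conf) (bundleIso K)

/-- the red label of `s ∧ B_K` along the identification -/
theorem SP.rLab_ser_bundle (s : SP) (K : ℕ) :
    (SP.ser s (SP.bundle K)).rLab = serR s.rLab (rB (K := K)) ∘ (sbsIso s K).symm.symm := by
  funext p
  obtain ⟨c, d⟩ := p
  show min (s.rLab c) ((SP.bundle K).rLab d) = min (s.rLab c) (K - (bundleIso K d).card)
  rw [SP.bundle_rLab, card_bundleIso]

/-- the blue label of `s ∧ B_K` along the identification -/
theorem SP.bLab_ser_bundle (s : SP) (K : ℕ) :
    (SP.ser s (SP.bundle K)).bLab = serB s.bLab (bB (K := K)) ∘ (sbsIso s K).symm.symm := by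
  funext p
  obtain ⟨c, d⟩ := p
  show min (s.bLab c) ((SP.bundle K).bLab d) = min (s.bLab c) (bundleIso K d).card
  rw [SP.bundle_bLab, card_bundleIso]

/-- **THEOREM: (UH*) on `s ∧ B_K` for every SP term `s` carrying the package `(f, θ, g)` and every
`K ≥ 3`** (MINE-B.md §25.2 on the cell's own terms). -/
theorem SP.universal_ser_bundle (s : SP) (K : ℕ) (hK : 3 ≤ K)
    (f : SlotL (USrc s.rLab s.bLab) s.bLab → s.Conf) (hf : Function.Injective f)
    (hfs : ∀ p, f p ≤ p.1.1.1 ∧ s.rLab (f p) = 1 ∧ s.bLab p.1.1.1 ≤ s.bLab (f p) + 1)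
    (θ : s.Conf → s.Conf)
    (hθ : ∀ x x', 1 ≤ s.rLab x → 2 ≤ s.bLab x → 1 ≤ s.rLab x' → 2 ≤ s.bLab x' → θ x = θ x' → x = x')
    (hθs : ∀ x, 1 ≤ s.rLab x → 2 ≤ s.bLab x → θ x ≤ x ∧ 2 ≤ s.rLab (θ x) ∧ s.bLab x ≤ s.bLab (θ x) + 1)
    (g : s.Conf → s.Conf)
    (hg1 : ∀ x, InD1 s.rLab s.bLab f x → g x ≤ x ∧ 1 ≤ s.rLab (g x))
    (hg2 : ∀ x, InD1 s.rLab s.bLab f x → ∀ q : SlotL (USrc s.rLab s.bLab) s.bLab, q.1.2.val = 0 → f q ≠ g x)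
    (hg3 : ∀ x, InD1 s.rLab s.bLab f x → ∀ x', 1 ≤ s.rLab x' → 2 ≤ s.bLab x' → θ x' ≠ g x)
    (hg4 : ∀ x x', InD1 s.rLab s.bLab f x → InD1 s.rLab s.bLab f x' → g x = g x' → x = x') :
    Universal (SP.ser s (SP.bundle K)).rLab (SP.ser s (SP.bundle K)).bLab := by
  rw [SP.rLab_ser_bundle, SP.bLab_ser_bundle]
  exact universal_transport (sbsIso s K).symm _ _
    (Summit.Ventures.PercRepro2.UHClosure.universal_ser_bundle hK s.rLab s.bLab f hf hfs θ hθ hθs g hg1 hg2 hg3 hg4)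

end Summit.Ventures.PercRepro2.V2Closure
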